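import Summits.ResolutionOfSingularities.ResolutionOfSingularities.Theorems.FrobeniusLadderFRationalResolutionRootAdjoinRegularTransport
import Mathlib.RingTheory.GradedAlgebra.Basic
import Mathlib.LinearAlgebra.Quotient.Basic
import HarnessLib

/-!
# Crux `FrobeniusLadder.FRationalResolution` (stmt-ResolutionOfSingularities-15317), line `redirect`,
# stub `stub_diagonalizableQuotientResolution` — item (F2b-core) of MEMO-15317-leafhand2-g21 §3 SETTLED by a quotient Euler
# derivation: the root-adjunction chart `S̃ = S[w]/(w^d − u)` is regular at the primes over the point as soon as `deg u` admits an
# additive character of the SUBGROUP `B` carrying the point (e.g. the unit-degree subgroup) — `deg u ∉ p·B` instead of `∉ p·A`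

Setting: `S` an `A`-graded `k`-algebra, `𝔔` a prime of `S`, `B ≤ A` a subgroup such that `S_i ⊆ 𝔔` for every `i ∉ B` (the
unit-degree subgroup of `𝔔` is the smallest such `B`), `u ∈ S_b ∖ 𝔔` with `b ∈ B`, and `χ : B →+ k` additive with `χ b` a unit.

* `exists_quotientEulerDerivation` — the ideal `I = ⟨S_i : i ∉ B⟩` is killed by "multiply `S_i` by `χ i` for `i ∈ B`": the
  `k`-linear map `s ↦ χ(deg s) s̄` is a derivation `S → S ⧸ I` (Leibniz holds because products with a factor of degree `∉ B`
  vanish in `S ⧸ I`), it vanishes on `I`, and so descends to a derivation `θ` of `S ⧸ I` with `θ s̄ = χ i • s̄` on `S_i`, `i ∈ B`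
  — the Euler derivation of the `B`-graded ring `S ⧸ I`, built without putting a grading on the quotient;
* ★★★ `isRegularLocalRing_localization_adjoinRoot_of_subgroupChar` — with `…RootAdjoinRegularTransport` (`I ⊆ 𝔓 ∩ S` because
  homogeneous elements of `𝔔` lie in every prime over the same point of `Spec S₀`, and `θ ū = χ b • ū ∉ (𝔓 ∩ S)/I`):
  **`AdjoinRoot (X^d − C u)` is a regular local ring at EVERY prime over the point** — the hypothesis `hreg` of
  `…FixedChartOfRoot.exists_fixed_chart_of_rootAdjoin`, discharged for `deg u ∉ p·B` (any `d`).

This closes the residual core of MEMO-15317-leafhand2-g21 §3: prototype `A = ℤ/p²`, `B = pA` (wild stabiliser `μ_p`), `b = p`,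
`d = p` — `b ∈ pA` (no character of `A` sees `b`, `…RootAdjoinRegularOfDerivation` does not apply) but `b ∉ pB = 0`, and
`χ : B = ⟨p⟩ ≅ ℤ/p → k` works. In general `B ≠ pB` exactly when `p ∣ |B|` (the wild case), so a degree `b ∈ B ∖ pB` with a unit
`u ∈ S_b` at the point always exists there: `hreg` is no longer an obstruction to the root-adjunction step (R) of the
re-charting pipeline (MEMO §2); what remains of (F2) is the group bookkeeping (F2c).

Honest label: helper toward ONE leaf stub; no stub, crux or summit closed. No definitions, no named facts, no sorry.
[folklore; cite: SGA3, Exp. VIII §4–5] [cite: Matsumura1987, Thm. 14.2; §25]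
-/

noncomputable section

-- single-problem summit: the doubled namespace component is forced
set_option linter.dupNamespace false

open IsLocalRing Polynomial DirectSum
open Literature.AlgebraicGeometry.Resolution

namespace Summit.ResolutionOfSingularities.ResolutionOfSingularities.Theorems.FRationalResolution.RootAdjoinRegularOfSubgroupChar

universe u v w

/-! ### The Euler derivation of a subgroup character on the quotient `S ⧸ ⟨S_i : i ∉ B⟩` -/

/-- **Quotient Euler derivation.** For an `A`-graded `k`-algebra `S`, a subgroup `B ≤ A` and an additive `χ : B →+ k`, let
`I = ⟨S_i : i ∉ B⟩`. There is a `k`-derivation `θ` of `S ⧸ I` with `θ s̄ = χ i • s̄` for `s ∈ S_i`, `i ∈ B`.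
[folklore; cite: SGA3, Exp. VIII §4–5] -/
theorem exists_quotientEulerDerivation {k : Type u} [CommRing k] {A : Type w} [DecidableEq A] [AddCommGroup A]
    {S : Type v} [CommRing S] [Algebra k S] (𝒮 : A → Submodule k S) [GradedAlgebra 𝒮] (B : AddSubgroup A) (χ : B →+ k) :
    ∃ θ : Derivation k (S ⧸ Ideal.span {s : S | ∃ i : A, i ∉ B ∧ s ∈ 𝒮 i})
        (S ⧸ Ideal.span {s : S | ∃ i : A, i ∉ B ∧ s ∈ 𝒮 i}),
      ∀ (i : A) (hi : i ∈ B) (s : S), s ∈ 𝒮 i →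
        θ (Ideal.Quotient.mk _ s) = χ ⟨i, hi⟩ • Ideal.Quotient.mk _ s := by
  classical
  set I : Ideal S := Ideal.span {s : S | ∃ i : A, i ∉ B ∧ s ∈ 𝒮 i} with hIdef
  -- the character extended by zero (only its values on `B` matter)
  let χ' : A → k := fun i => if h : i ∈ B then χ ⟨i, h⟩ else 0
  have hχ'B : ∀ i (hi : i ∈ B), χ' i = χ ⟨i, hi⟩ := fun i hi => dif_pos hi
  have hχ'add : ∀ i j, i ∈ B → j ∈ B → χ' (i + j) = χ' i + χ' j := by
    intro i j hi hj
    rw [hχ'B i hi, hχ'B j hj, hχ'B (i + j) (B.add_mem hi hj), ← map_add]; rfl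
  -- generators of `I` die in the quotient
  have hmk0 : ∀ i, i ∉ B → ∀ s ∈ 𝒮 i, (Ideal.Quotient.mk I s) = 0 := fun i hi s hs =>
    Ideal.Quotient.eq_zero_iff_mem.2 (Ideal.subset_span ⟨i, hi, hs⟩)
  -- the `k`-linear map `s ↦ χ'(deg s) • s` on `S`
  let L : S →ₗ[k] S :=
    (DirectSum.toModule k A S fun i => χ' i • (𝒮 i).subtype) ∘ₗ (decomposeLinearEquiv 𝒮).toLinearMap
  have hL : ∀ (i : A) (s : S), s ∈ 𝒮 i → L s = χ' i • s := by
    intro i s hs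
    simp only [L, LinearMap.coe_comp, Function.comp_apply, LinearEquiv.coe_toLinearMap, decomposeLinearEquiv_apply,
      decompose_of_mem 𝒮 hs, ← lof_eq_of k, toModule_lof, LinearMap.smul_apply, Submodule.subtype_apply]
  -- composed with the quotient map it is a derivation `S → S ⧸ I`
  let δ₀ : S →ₗ[k] (S ⧸ I) := (Ideal.Quotient.mkₐ k I).toLinearMap ∘ₗ L
  have hδ₀ : ∀ (i : A) (s : S), s ∈ 𝒮 i → δ₀ s = χ' i • Ideal.Quotient.mk I s := by
    intro i s hs
    simp only [δ₀, LinearMap.coe_comp, Function.comp_apply, hL i s hs, map_smul, AlgHom.toLinearMap_apply,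
      Ideal.Quotient.mkₐ_eq_mk]
  have hsmul : ∀ (a : S) (q : S ⧸ I), a • q = Ideal.Quotient.mk I a * q := fun a q => by
    rw [Algebra.smul_def, Ideal.Quotient.algebraMap_eq]
  have hleib : ∀ a b : S, δ₀ (a * b) = a • δ₀ b + b • δ₀ a := by
    intro a b
    induction a using DirectSum.Decomposition.inductionOn 𝒮 with
    | zero => simp
    | add a a' ha ha' => simp only [add_mul, map_add, ha, ha', smul_add, add_smul]; abel
    | homogeneous x =>
      induction b using DirectSum.Decomposition.inductionOn 𝒮 with
      | zero => simp
      | add b b' hb hb' => simp only [mul_add, map_add, hb, hb', smul_add, add_smul]; abel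
      | homogeneous y =>
        rename_i i j
        rw [hδ₀ (i + j) _ (SetLike.mul_mem_graded x.2 y.2), hδ₀ j _ y.2, hδ₀ i _ x.2, smul_comm (x : S),
          smul_comm (y : S), hsmul, hsmul, ← map_mul, ← map_mul, mul_comm (y : S) (x : S)]
        by_cases hi : i ∈ B
        · by_cases hj : j ∈ B
          · rw [hχ'add i j hi hj, add_smul, add_comm]
          · rw [show Ideal.Quotient.mk I ((x : S) * y) = 0 from by
                rw [map_mul, hmk0 j hj _ y.2, mul_zero]]
            simp only [smul_zero, add_zero]
        · rw [show Ideal.Quotient.mk I ((x : S) * y) = 0 from by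
              rw [map_mul, hmk0 i hi _ x.2, zero_mul]]
          simp only [smul_zero, add_zero]
  let δ : Derivation k S (S ⧸ I) := Derivation.mk' δ₀ hleib
  have hδ : ∀ s, δ s = δ₀ s := fun s => rfl
  -- `δ` vanishes on `I`
  have hδI : ∀ x ∈ I, δ x = 0 := by
    intro x hx
    induction hx using Submodule.span_induction with
    | mem s hs =>
      obtain ⟨i, hi, hs⟩ := hs
      rw [hδ, hδ₀ i s hs, hmk0 i hi s hs, smul_zero]
    | zero => exact map_zero δ
    | add x y _ _ hx hy => rw [map_add, hx, hy, add_zero]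
    | smul a x hx hx' =>
      rw [smul_eq_mul, Derivation.leibniz, hx', smul_zero, zero_add, hsmul, Ideal.Quotient.eq_zero_iff_mem.2 hx, zero_mul]
  -- descend to `S ⧸ I`
  let θ₀ : (S ⧸ I) →ₗ[k] (S ⧸ I) :=
    ((I.restrictScalars k).liftQ δ.toLinearMap fun x hx => by
        rw [LinearMap.mem_ker]; exact hδI x hx) ∘ₗ
      (Submodule.Quotient.restrictScalarsEquiv k I).symm.toLinearMap
  have hθ₀ : ∀ s : S, θ₀ (Ideal.Quotient.mk I s) = δ s := by
    intro s
    simp only [θ₀, LinearMap.coe_comp, Function.comp_apply, LinearEquiv.coe_toLinearMap, ← Ideal.Quotient.mk_eq_mk,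
      Submodule.Quotient.restrictScalarsEquiv_symm_mk, Submodule.liftQ_apply]
    rfl
  have hθleib : ∀ a b : S ⧸ I, θ₀ (a * b) = a • θ₀ b + b • θ₀ a := by
    intro a b
    obtain ⟨a, rfl⟩ := Ideal.Quotient.mk_surjective a
    obtain ⟨b, rfl⟩ := Ideal.Quotient.mk_surjective b
    rw [← map_mul, hθ₀, hθ₀, hθ₀, Derivation.leibniz, hsmul, hsmul, smul_eq_mul, smul_eq_mul]
  refine ⟨Derivation.mk' θ₀ hθleib, fun i hi s hs => ?_⟩
  rw [Derivation.coe_mk', hθ₀, hδ, hδ₀ i s hs, hχ'B i hi]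

/-! ### `hreg` discharged by a subgroup character -/

/-- ★★★ **The root-adjunction chart is regular at the primes over the point when `deg u` admits an additive character of a
subgroup carrying the point.** `S` regular, graded by the torsion group `A` over `k`; `𝔔` a prime of `S`; `B ≤ A` with `S_i ⊆ 𝔔`
for all `i ∉ B`; `u ∈ S_b ∖ 𝔔` with `b ∈ B`; `χ : B →+ k` with `χ b` a unit. Then `AdjoinRoot (X^d − C u)` is a regular local ring
at EVERY prime `𝔓` over the point `𝔮 = 𝔔 ∩ S₀` — the hypothesis `hreg` of `…FixedChartOfRoot.exists_fixed_chart_of_rootAdjoin`.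
(In characteristic `p` such a `χ` exists iff `b ∉ p·B`; for `B = A` this is `…RootAdjoinRegularOfDerivation…of_addChar`.)
[folklore; cite: SGA3, Exp. VIII §4–5] [cite: Matsumura1987, Thm. 14.2; §25] -/
theorem isRegularLocalRing_localization_adjoinRoot_of_subgroupChar {k : Type u} [CommRing k] {A : Type w} [DecidableEq A]
    [AddCommGroup A] {S : Type u} [CommRing S] [Algebra k S] (𝒮 : A → Submodule k S) [GradedAlgebra 𝒮] [IsRegularRing S]
    (hA : AddMonoid.IsTorsion A) (𝔔 : Ideal S) [𝔔.IsPrime] (B : AddSubgroup A)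
    (hB : ∀ i : A, i ∉ B → ∀ s ∈ 𝒮 i, s ∈ 𝔔) {b : A} (hb : b ∈ B) {u : S} (hu : u ∈ 𝒮 b) (huQ : u ∉ 𝔔)
    (χ : B →+ k) (hχ : IsUnit (χ ⟨b, hb⟩)) (d : ℕ)
    (𝔓 : Ideal (AdjoinRoot (X ^ d - C u : S[X]))) [𝔓.IsPrime]
    (h𝔓 : 𝔓.comap (algebraMap (𝒮 0) (AdjoinRoot (X ^ d - C u : S[X]))) = 𝔔.comap (algebraMap (𝒮 0) S)) :
    IsRegularLocalRing (Localization.AtPrime 𝔓) := by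
  classical
  -- the prime `𝔔₁ = 𝔓 ∩ S` lies over the same point of `Spec S₀` as `𝔔`
  set 𝔔₁ : Ideal S := 𝔓.comap (AdjoinRoot.of (X ^ d - C u : S[X])) with h𝔔₁
  haveI : 𝔔₁.IsPrime := Ideal.IsPrime.comap _
  have h𝔔₁0 : 𝔔₁.comap (algebraMap (𝒮 0) S) = 𝔔.comap (algebraMap (𝒮 0) S) := by
    rw [← h𝔓, h𝔔₁, Ideal.comap_comap]; rfl
  -- homogeneous elements: `s ∈ 𝔔 ↔ s ∈ 𝔔₁` (a power of `s` is of degree zero)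
  have hhom : ∀ (i : A) (s : S), s ∈ 𝒮 i → (s ∈ 𝔔 ↔ s ∈ 𝔔₁) := by
    intro i s hs
    have hpow : s ^ addOrderOf i ∈ 𝒮 0 := DiagonalizableQuotient.pow_addOrderOf_mem_gradeZero 𝒮 hs
    have hn : 0 < addOrderOf i := (hA i).addOrderOf_pos
    constructor
    · intro h
      have h1 : (⟨s ^ addOrderOf i, hpow⟩ : 𝒮 0) ∈ 𝔔₁.comap (algebraMap (𝒮 0) S) := by
        rw [h𝔔₁0, Ideal.mem_comap]; exact 𝔔.pow_mem_of_mem h _ hn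
      exact (inferInstance : 𝔔₁.IsPrime).mem_of_pow_mem _ (Ideal.mem_comap.1 h1)
    · intro h
      have h1 : (⟨s ^ addOrderOf i, hpow⟩ : 𝒮 0) ∈ 𝔔.comap (algebraMap (𝒮 0) S) := by
        rw [← h𝔔₁0, Ideal.mem_comap]; exact 𝔔₁.pow_mem_of_mem h _ hn
      exact (inferInstance : 𝔔.IsPrime).mem_of_pow_mem _ (Ideal.mem_comap.1 h1)
  -- the ideal `I = ⟨S_i : i ∉ B⟩` lies inside `𝔔₁`
  have hI : Ideal.span {s : S | ∃ i : A, i ∉ B ∧ s ∈ 𝒮 i} ≤ 𝔔₁ := by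
    refine Ideal.span_le.2 ?_
    rintro s ⟨i, hi, hs⟩
    exact (hhom i s hs).1 (hB i hi s hs)
  obtain ⟨θ, hθ⟩ := exists_quotientEulerDerivation 𝒮 B χ
  refine RootAdjoinRegularTransport.isRegularLocalRing_localization_adjoinRoot_of_quotient_derivation _
    (θ.restrictScalars ℤ) u d 𝔓 hI ?_
  -- `θ ū = χ b • ū ∉ 𝔔₁/I`
  have hsm : (θ.restrictScalars ℤ) (Ideal.Quotient.mk _ u) = Ideal.Quotient.mk _ (χ ⟨b, hb⟩ • u) := by
    rw [Derivation.restrictScalars_apply, hθ b hb u hu, ← Ideal.Quotient.mkₐ_eq_mk k, map_smul]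
  rw [hsm, Ideal.mem_quotient_iff_mem hI]
  intro h
  obtain ⟨c, hc⟩ := hχ.exists_left_inv
  have : u ∈ 𝔔₁ := by
    have h2 := 𝔔₁.mul_mem_left (algebraMap k S c) h
    rw [Algebra.smul_def, ← mul_assoc, ← map_mul, hc, map_one, one_mul] at h2
    exact h2
  exact huQ ((hhom b u hu).2 this)

end Summit.ResolutionOfSingularities.ResolutionOfSingularities.Theorems.FRationalResolution.RootAdjoinRegularOfSubgroupChar

end
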